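import Literature.Geometry.Lorentzian.PenroseRigidity
import HarnessLib

/-!
# Bray's Theorem 19, case of equality, for exterior regions: the §13 assembly on its three
# inputs, proved (namespace `Literature.Geometry.Lorentzian`)

`PenroseRigidity.lean` vendors the case of equality of Bray, J. Differential Geom. 59 (2001)
177–267 (arXiv:math/9911173, same numbering), Thm. 19 (p. 240), in the exterior-region encoding,
as the **named fact** `Bray2001_penrose_rigidity_exteriorRegion`: for an exterior region `U` of
the complete data manifold `(X, h)` with compact minimal boundary `∂U = range B.f`, one end `e`
(Def. 21 decay, `|R| = O(r^{-q})`, `q > 3`, the flux limit (225) existing), `R ≥ 0` on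
`closure U`, no other compact immersed minimal surface in `closure U`, and equality
`√(|Σ₀|/16π) = m := e.admEnergy D` for a nonempty compact surface `Σ₀` smoothly embedded into
`∂U`, the region `U` is isometric to the Schwarzschild manifold of mass `m` outside its horizon.

Bray's proof (§13, the paragraph following Thm. 18, read for `M'` the metric completion of `U`
by the remark preceding Thm. 19) has three inputs, two of which the tree already names:

1. `Bray2001_capacity_eq_of_penrose_eq` (`PenroseRigidity.lean`) — equality in the Penrose
   inequality forces `ℰ(∂M', g) = 2m` (Thm. 18 = Thms. 2–3 for asymptotically flat manifolds,
   (226) along the conformal flow, and the derivative formula of §7; the paragraph itself is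
   machine-checked on those inputs in `PenroseRigidityFlow.lean`);
2. `Bray2001_oneSided_of_penrose_eq` (`PenroseRigidity.lean`) — in the case of equality no
   component of `∂U` is doubled in `∂M'`, i.e. `U` lies on the side of `∂U` its normal points to;
3. the case of equality of Thm. 9 (§6; p. 16 of arXiv:math/9911173, whose numbering is the
   journal's: *`m ≥ ½ ℰ(Σ, g)`, with equality if and only if `(M³, g)` is a Schwarzschild
   manifold outside the horizon `Σ`*), **for the exterior region**: its proof (pp. 16–18 there:
   reflection of `M³_Σ` through `Σ`, smoothing of the Lipschitz doubled metric, Thm. 8 and, for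
   the case of equality, the singular positive mass rigidity of Bray–Finster [BF, Thm. 5.3]) only
   ever sees the closed region `M³_Σ` outside (or on) `Σ`, so it applies verbatim to `M'`; the
   tree's `Bray2001_capacity_rigidity` (`MassCapacity.lean`) is the same statement for a horizon
   of a boundaryless `(X, h)` with `R ≥ 0` on all of `X`, `k = 0` and Def. 21 decay of `(h, k)`.

This file proves the assembly: inputs 1 and 2 (as the named facts) together with input 3 —
taken as an explicit hypothesis `h9x`, spelled exactly as `Bray2001_capacity_rigidity` with
(i) `D.IsTimeSymmetric` dropped (the tensor `k` plays no role), (ii) `R ≥ 0` assumed on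
`closure U` only, (iii) Def. 21 decay of the metric alone (`IsMetricAsymptoticallyFlat`) — imply
`Bray2001_penrose_rigidity_exteriorRegion`. The proof is the last sentence of §13: with
`ℰ(∂U)/2 = m` (input 1) and `U` on one side of `∂U` (input 2), `U` is the outside of the
horizon `∂U ∈ 𝒮` towards `e` (`IsOutsideOf e U B.f B.ν`), `∂U` is nonempty since `Σ₀ ≠ ∅`
embeds into it, and input 3 gives the isometry with the Schwarzschild exterior of mass `m`.
So a discharge `Bray2001_penrose_rigidity_exteriorRegion_holds` is exactly: discharges of the
two named facts, and a proof of Thm. 9's case of equality in the form `h9x`.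

No new definitions and no named facts are introduced (D-0026); input 3 is deliberately **not**
vendored as a further named fact here — it is a hypothesis of the one theorem that uses it.

## References

* H. L. Bray, *Proof of the Riemannian Penrose inequality using the positive mass theorem*,
  J. Differential Geom. 59 (2001) 177–267 (arXiv:math/9911173): §6 Def. 17, Thm. 9 and its
  proof; §13 Thm. 18, Thm. 19 and the proof of the case of equality. (key `BrayRPI2001`)
* H. L. Bray, F. Finster, *Curvature estimates and the positive mass theorem*, Comm. Anal.
  Geom. 10 (2002), Thm. 5.3 (cited as [BF] by Bray; not used formally here).
* G. Huisken, T. Ilmanen, *The inverse mean curvature flow and the Riemannian Penrose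
  inequality*, J. Differential Geom. 59 (2001), §4, Lemma 4.1 (ii). (key `HuiskenIlmanenIMCF2001`)
-/

noncomputable section

open Bundle Set Manifold TopologicalSpace Filter MeasureTheory Asymptotics
open scoped ContDiff Topology ENNReal Manifold Real

namespace Literature.Geometry.Lorentzian

open PseudoRiemannianMetric

/-- **Bray's Thm. 19, case of equality, for exterior regions, assembled from §13 and Thm. 9
(proved on its inputs).** The named facts `Bray2001_capacity_eq_of_penrose_eq` (Bray,
J. Differential Geom. 59 (2001), §13: equality in the Penrose inequality forces
`ℰ(∂M', g) = 2m`) and `Bray2001_oneSided_of_penrose_eq` (Thm. 19 bookkeeping: in the case of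
equality no boundary component is doubled), together with the case of equality of Thm. 9 (§6)
for the exterior region — hypothesis `h9x`: for a compact surface `Σ = range f'` smoothly
embedded in the complete `(X, h)` with smooth unit normal `ν'` and `H = 0`, `U` the outside of
`Σ` towards the end `e` (`IsOutsideOf e U f' ν'`), `R(h) ≥ 0` on `closure U`, Def. 21 decay of
`h` on `e` with `|R| = O(r^{-q})`, `q > 3`, the flux limit (225) existing, and `Σ ≠ ∅`, equality
`ℰ(Σ, g)/2 = m` forces `U ≅ ({m/2 < ‖y‖}, (1 + m/2‖y‖)⁴ δ)`, `m = e.admEnergy D`; this is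
`Bray2001_capacity_rigidity` of `MassCapacity.lean` with `D.IsTimeSymmetric` dropped, `R ≥ 0`
on `closure U` instead of `X`, and `IsMetricAsymptoticallyFlat` instead of
`IsAsymptoticallyFlat` (Bray's proof of Thm. 9, pp. 16–18 of the arXiv version, works on `M³_Σ`
only) — imply `Bray2001_penrose_rigidity_exteriorRegion`. Proof (§13, last sentence of the case
of equality: *"Then by the case of equality of Theorem 9, `(M³, g)` is a Schwarzschild manifold
outside `Σ⁺(0)`"*): for the data of the fact, form the capacity with the Borel structure
`borel X` and `Manifold.locallyCompact_of_finiteDimensional`; §13 gives `ℰ(∂U)/2 = m` and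
one-sidedness, so `IsOutsideOf e U B.f B.ν` (`B.frontier_eq`, `B.pointsInto`,
`IsExteriorRegion e U`); `B.surf` is nonempty as `Σ₀ ≠ ∅` embeds into `∂U = range B.f`; and `h9x`
applied to the horizon `B` (`B.isMinimal`) is the conclusion.
[cite: BrayRPI2001, §13, proof of the case of equality (after Thm. 18), with Thm. 9 (§6) and Thm. 19] -/
theorem Bray2001_penrose_rigidity_exteriorRegion_of_exterior_capacity_rigidity
    (h13 : Bray2001_capacity_eq_of_penrose_eq) (h13' : Bray2001_oneSided_of_penrose_eq)
    (h9x : ∀ (X : Type) [TopologicalSpace X] [ChartedSpace E3 X] [IsManifold (𝓡 3) ∞ X]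
      [T2Space X] [SecondCountableTopology X] [LocallyCompactSpace X] [ConnectedSpace X]
      [MeasurableSpace X] [BorelSpace X]
      (D : InitialDataSet (𝓡 3) X) [D.metric.HasLeviCivita] (e : AFEnd X) (U : Opens X)
      (S' : Type) [TopologicalSpace S'] [ChartedSpace (EuclideanSpace ℝ (Fin 2)) S']
      [IsManifold (𝓡 2) ∞ S'] [CompactSpace S'] [T2Space S'] (f' : S' → X)
      (ν' : NormalField (𝓡 3) f')
      (hpb' : PseudoRiemannianMetric.contMDiff_pullbackBilin (𝓡 3) X (𝓡 2) S' ∞)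
      (hf' : (ofRiemannian D.h).IsSpacelikeImmersion (𝓡 2) f'),
      (∀ x ∈ closure (U : Set X), 0 ≤ D.metric.scalarCurvature x) →
      e.IsMetricAsymptoticallyFlat D 1 →
      (∃ q : ℝ, 3 < q ∧
        (fun x ↦ e.scalarCurvatureCoeff D x) =O[Bornology.cobounded E3] fun x ↦ ‖x‖ ^ (-q)) →
      D.IsComplete → (∃ m, e.HasADMEnergy D m) →
      Manifold.IsSmoothEmbedding (𝓡 2) (𝓡 3) ∞ f' →
      (ofRiemannian D.h).IsUnitNormal (𝓡 2) f' ν' 1 →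
      (ofRiemannian D.h).IsMaximalSlice f' hpb' hf' ν' → IsOutsideOf e U f' ν' → Nonempty S' →
      (horizonCapacity D.h e U).toReal / 2 = e.admEnergy D →
      ∃ Φ : Diffeomorph (𝓡 3) (𝓡 3) U (exteriorRegion (e.admEnergy D / 2)) ∞,
        ∀ x : U, pullbackBilin (I := 𝓡 3) (I' := 𝓡 3) Φ
          (fun y ↦ (1 + e.admEnergy D / (2 * ‖(y : E3)‖)) ^ 4 •
            (innerSL ℝ (E := E3) : E3 →L[ℝ] E3 →L[ℝ] ℝ)) x = D.metric.val x.1) :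
    Bray2001_penrose_rigidity_exteriorRegion := by
  intro X _ _ _ _ _ _ D _ e U B hcomp hext hAF hRq hADM hR hiii S₀ _ _ _ _ _ _ _ f₀ hpb₀ hf₀ hemb
    hsub hne heq
  -- the Borel structure and local compactness of `X`, to form the capacity
  letI : MeasurableSpace X := borel X
  haveI : BorelSpace X := ⟨rfl⟩
  haveI : LocallyCompactSpace X := Manifold.locallyCompact_of_finiteDimensional (M := X) (𝓡 3)
  -- §13: `ℰ(∂U)/2 = m`, and `U` lies on one side of `∂U`
  have hcap := h13 X D e U B hcomp hext hAF hRq hADM hR hiii S₀ f₀ hpb₀ hf₀ hemb hsub hne heq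
  have hside := h13' X D e U B hcomp hext hAF hRq hADM hR hiii S₀ f₀ hpb₀ hf₀ hemb hsub hne heq
  -- `U` is the outside of the horizon `∂U ∈ 𝒮` towards `e`, and `∂U ≠ ∅`
  have hout : IsOutsideOf e U B.f B.ν := ⟨B.frontier_eq, B.pointsInto, hside, hext⟩
  have hBne : Nonempty B.surf := by
    obtain ⟨y⟩ := hne
    obtain ⟨z, -⟩ : f₀ y ∈ range B.f := hsub (mem_range_self y)
    exact ⟨z⟩
  -- Thm. 9, case of equality, for the horizon `∂U` of the exterior region `U`
  exact h9x X D e U B.surf B.f B.ν B.hpb B.isSpacelikeImmersion hR hAF hRq hcomp hADM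
    B.isEmbedding B.isUnitNormal B.isMinimal hout hBne hcap

/-- **The exterior-region form of Thm. 9's case of equality implies the whole-manifold form.**
The hypothesis `h9x` of `Bray2001_penrose_rigidity_exteriorRegion_of_exterior_capacity_rigidity`
(Bray, J. Differential Geom. 59 (2001), Thm. 9 (§6), case of equality, for the outside `U` of a
horizon with `R ≥ 0` on `closure U` and Def. 21 decay of the metric) implies the named fact
`Bray2001_capacity_rigidity` of `MassCapacity.lean` (the same for a horizon of the boundaryless
`(X, h)` with `R ≥ 0` on `X`, `k = 0` and Def. 21 decay of `(h, k)`): `R ≥ 0` on `X` restricts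
to `closure U`, asymptotic flatness of `(h, k)` contains that of `h`
(`AFEnd.IsAsymptoticallyFlat.isMetricAsymptoticallyFlat`), and `k = 0` is not used. So one proof
of Thm. 9's case of equality in the form `h9x` discharges both lines of the §13 assembly
(`riemannian_penrose_rigidity_outermost_of_capacity_rigidity'` of `PenroseRigidityProofs.lean`,
and `Bray2001_penrose_rigidity_exteriorRegion` through
`Bray2001_penrose_rigidity_exteriorRegion_of_exterior_capacity_rigidity`).
[cite: BrayRPI2001, Thm. 9 (§6) equality case] -/
theorem Bray2001_capacity_rigidity_of_exterior_capacity_rigidity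
    (h9x : ∀ (X : Type) [TopologicalSpace X] [ChartedSpace E3 X] [IsManifold (𝓡 3) ∞ X]
      [T2Space X] [SecondCountableTopology X] [LocallyCompactSpace X] [ConnectedSpace X]
      [MeasurableSpace X] [BorelSpace X]
      (D : InitialDataSet (𝓡 3) X) [D.metric.HasLeviCivita] (e : AFEnd X) (U : Opens X)
      (S' : Type) [TopologicalSpace S'] [ChartedSpace (EuclideanSpace ℝ (Fin 2)) S']
      [IsManifold (𝓡 2) ∞ S'] [CompactSpace S'] [T2Space S'] (f' : S' → X)
      (ν' : NormalField (𝓡 3) f')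
      (hpb' : PseudoRiemannianMetric.contMDiff_pullbackBilin (𝓡 3) X (𝓡 2) S' ∞)
      (hf' : (ofRiemannian D.h).IsSpacelikeImmersion (𝓡 2) f'),
      (∀ x ∈ closure (U : Set X), 0 ≤ D.metric.scalarCurvature x) →
      e.IsMetricAsymptoticallyFlat D 1 →
      (∃ q : ℝ, 3 < q ∧
        (fun x ↦ e.scalarCurvatureCoeff D x) =O[Bornology.cobounded E3] fun x ↦ ‖x‖ ^ (-q)) →
      D.IsComplete → (∃ m, e.HasADMEnergy D m) →
      Manifold.IsSmoothEmbedding (𝓡 2) (𝓡 3) ∞ f' →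
      (ofRiemannian D.h).IsUnitNormal (𝓡 2) f' ν' 1 →
      (ofRiemannian D.h).IsMaximalSlice f' hpb' hf' ν' → IsOutsideOf e U f' ν' → Nonempty S' →
      (horizonCapacity D.h e U).toReal / 2 = e.admEnergy D →
      ∃ Φ : Diffeomorph (𝓡 3) (𝓡 3) U (exteriorRegion (e.admEnergy D / 2)) ∞,
        ∀ x : U, pullbackBilin (I := 𝓡 3) (I' := 𝓡 3) Φ
          (fun y ↦ (1 + e.admEnergy D / (2 * ‖(y : E3)‖)) ^ 4 •
            (innerSL ℝ (E := E3) : E3 →L[ℝ] E3 →L[ℝ] ℝ)) x = D.metric.val x.1) :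
    Bray2001_capacity_rigidity := by
  intro X _ _ _ _ _ _ _ _ _ D _ e U S' _ _ _ _ _ f' ν' hpb' hf' _hts hR hAF hRq hcomp hADM hemb hν
    hmin hout hne hcap
  exact h9x X D e U S' f' ν' hpb' hf' (fun x _ ↦ hR x) hAF.isMetricAsymptoticallyFlat hRq hcomp
    hADM hemb hν hmin hout hne hcap

end Literature.Geometry.Lorentzian

end
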